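import Summits.QuantumAdvantage.QuantumAdvantage.Theorems.CharDialJLinPeel
import Summits.QuantumAdvantage.QuantumAdvantage.Theorems.CharDialUnreadTwist
import HarnessLib

/-!
# Cell qa-qnc0 / decomp-qadv (odd primes): the ONE-STEP HYBRID (peeling) LAW for junta ⊕ linear-form strategies — PROVED

TREE-READY PART 2/3 of the node `HOME/decomp-qadv-lens-6/g9/PeelDial.lean` (decomp-qadv-lens-6 g9, §14), ZERO `def … : Prop`.

**`hybrid_step`** (`p ≠ 3`): there are `C = 3p` and `ρ = cos(π/(3p)) < 1` such that for every data `D : JLinData p n`,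
charge `c` and cut `g` some residue `κ` satisfies

    #win(D) ≤ C·ρ^{priv_D(g)}·2ⁿ + #win(D.freeze g κ).

Proof.  (1) POINTWISE COUPLING `strat_freeze_form`: `D` and `D.freeze g (form_g u)` answer identically at `u`, so
`[win_D u] = Σ_κ [form_g(u) = κ]·[win_{D_κ} u]` (`winCount_eq_sum`).  (2) ORTHOGONALITY
(`Literature.Analysis.Fourier.sum_stdAddChar_mul`): `p·[form_g(u) = κ] = Σ_t e_p((form_g(u) − κ)t)`, whence
`p·#win(D) − Σ_κ #win(D_κ) = Σ_κ Σ_{t ≠ 0} Σ_u e_p((form_g(u) − κ)t)[win_{D_κ} u]`.  (3) Each inner sum is bounded by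
the UNREAD twisted correlation bound `UnreadTwist.unread_corr_win_le` (part `CharDialUnreadTwist`) with `P = privSet_D(g)`,
`β = t·a g` (non-zero on `P ⊆ supp (a g)`): `D_κ` is BLIND to `P` (`strat_freeze_blind` — the other cuts by definition of
privacy, cut `g` because its form is now constant and `P ∩ J g = ∅`).  So `p·#win(D) − Σ_κ #win(D_κ) ≤ p²·3ρ^{|P|}2ⁿ`
(`peel_defect_le`) and the best `κ` (`Finset.exists_max_image`) gives the claim.

Consequences (part 3/3, `CharDialJLinCore.lean`): the EXCLUSIVE rung is a theorem, and CharDial's item 32604 (and R5) are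
EQUIVALENT to hardness on `L`-cores.
-/

noncomputable section

namespace Summit.QuantumAdvantage.AdviceFreeQNC0.JLinPeel

open Finset Summit.QuantumAdvantage.AdviceFreeQNC0 TwistedTransfer JLinData

section Hybrid

variable {p : ℕ} [Fact p.Prime] {n : ℕ}

omit [Fact p.Prime] in
/-- CharDial sub-characteristic helper `freeze_h_apply` (lens-6 g8 LAND package; see the module docstring). -/
theorem freeze_h_apply (D : JLinData p n) (g g' : Fin (n + 1)) (κ : ZMod p) (u : Fin n → Bool) (s : ZMod p) :
    (D.freeze g κ).h g' u s = if g' = g then D.h g u κ else D.h g' u s := rfl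

omit [Fact p.Prime] in
/-- CharDial sub-characteristic helper `form_freeze_ne'` (lens-6 g8 LAND package; see the module docstring). -/
theorem form_freeze_ne' (D : JLinData p n) {g g' : Fin (n + 1)} (hg : g' ≠ g) (κ : ZMod p) (u : Fin n → Bool) :
    (D.freeze g κ).form g' u = D.form g' u := by
  unfold form freeze
  simp [hg]

omit [Fact p.Prime] in
/-- POINTWISE COUPLING: freezing cut `g` at the value its form takes at `u` changes no answer at `u`. -/
theorem strat_freeze_form (D : JLinData p n) (g g' : Fin (n + 1)) (u : Fin n → Bool) :
    (D.freeze g (D.form g u)).strat g' u = D.strat g' u := by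
  unfold strat
  rw [freeze_h_apply]
  by_cases hg : g' = g
  · rw [if_pos hg, hg]
  · rw [if_neg hg, form_freeze_ne' D hg]

/-- The frozen strategy is BLIND to the private bits of the frozen cut. -/
theorem strat_freeze_blind (D : JLinData p n) (g : Fin (n + 1)) (κ : ZMod p) (g' : Fin (n + 1)) (u v : Fin n → Bool)
    (huv : ∀ i : Fin n, i ∉ D.privSet g → u i = v i) :
    (D.freeze g κ).strat g' u = (D.freeze g κ).strat g' v := by
  have hJ : ∀ i ∈ D.J g', u i = v i := by
    intro i hi
    apply huv
    intro hP
    unfold privSet at hP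
    rw [mem_filter] at hP
    by_cases hg : g' = g
    · rw [hg] at hi; exact hP.2.1 hi
    · exact hP.2.2 g' hg (by unfold readSet; exact mem_union.2 (Or.inl hi))
  unfold strat
  rw [freeze_h_apply, freeze_h_apply]
  by_cases hg : g' = g
  · rw [if_pos hg, if_pos hg]
    rw [hg] at hJ
    exact D.hJ g u v hJ κ
  · rw [if_neg hg, if_neg hg, form_freeze_ne' D hg, form_freeze_ne' D hg]
    have hform : D.form g' u = D.form g' v := by
      unfold form
      refine Finset.sum_congr rfl fun i _ => ?_
      by_cases ha : D.a g' i = 0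
      · simp [ha]
      · have hi : u i = v i := huv i fun hP => by
          unfold privSet at hP
          rw [mem_filter] at hP
          exact hP.2.2 g' hg (by
            unfold readSet suppForm
            exact mem_union.2 (Or.inr (mem_filter.2 ⟨mem_univ _, ha⟩)))
        rw [hi]
    rw [hform, D.hJ g' u v hJ]

/-- The win count as a sum of indicators. -/
theorem winCount_eq_sum (c : ℕ) (y : Fin (n + 1) → (Fin n → Bool) → Bool) :
    ((winCount c y : ℕ) : ℂ) = ∑ u : Fin n → Bool, (if ringWinU c y u = true then (1 : ℂ) else 0) := by
  unfold winCount
  rw [Finset.natCast_card_filter]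

/-- **The peeling defect bound**: `p·#win(D) − Σ_κ #win(D.freeze g κ) ≤ p²·3ρ^{priv_D(g)}·2ⁿ` — pointwise coupling,
orthogonality of the characters of `𝔽_p`, and the unread twisted correlation bound applied to each frozen strategy
(which is blind to the private bits of `g`). -/
theorem peel_defect_le {ρ : ℝ} (hρ : 0 ≤ ρ)
    (hsite : ∀ a : ZMod p, a ≠ 0 → ∀ v : ZMod 3 → ℂ, cnsq (twAvg (ZMod.stdAddChar a) v) ≤ ρ ^ 2 * cnsq v)
    (c : ℕ) (D : JLinData p n) (g : Fin (n + 1)) :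
    (p : ℝ) * (winCount c D.strat : ℝ) - ∑ κ : ZMod p, (winCount c (D.freeze g κ).strat : ℝ) ≤
      (p : ℝ) * (p : ℝ) * (3 * ρ ^ D.priv g * (2 : ℝ) ^ n) := by
  classical
  set W : ZMod p → (Fin n → Bool) → ℂ := fun κ u =>
    if ringWinU c (D.freeze g κ).strat u = true then (1 : ℂ) else 0 with hW
  set ψ : ZMod p → (Fin n → Bool) → ZMod p → ℂ := fun κ u t =>
    (ZMod.stdAddChar ((D.form g u - κ) * t) : ℂ) with hψ
  -- (1) coupling: `[win_D u] = Σ_κ [ℓ u = κ]·W κ u`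
  have hcouple : ∀ u : Fin n → Bool, (if ringWinU c D.strat u = true then (1 : ℂ) else 0) =
      ∑ κ : ZMod p, (if D.form g u = κ then W κ u else 0) := by
    intro u
    rw [Finset.sum_ite_eq, if_pos (mem_univ _), hW]
    simp only
    rw [UnreadTwist.ringWinU_congr (y' := (D.freeze g (D.form g u)).strat) (fun g' => (strat_freeze_form D g g' u).symm)]
  -- (2) orthogonality: `p·[ℓ u = κ]·W = Σ_t ψ((ℓu − κ)t)·W`
  have horth : ∀ (u : Fin n → Bool) (κ : ZMod p), (p : ℂ) * (if D.form g u = κ then W κ u else 0) =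
      ∑ t : ZMod p, ψ κ u t * W κ u := by
    intro u κ
    rw [hψ]
    simp only
    rw [← Finset.sum_mul, Literature.Analysis.Fourier.sum_stdAddChar_mul]
    by_cases h : D.form g u = κ
    · rw [if_pos h, if_pos (sub_eq_zero.mpr h)]
    · rw [if_neg h, if_neg (fun h' => h (sub_eq_zero.mp h')), mul_zero, zero_mul]
  -- (3) the defect as a character sum over `t ≠ 0`
  have h0mem : (0 : ZMod p) ∈ (univ : Finset (ZMod p)) := mem_univ _
  have hdefect : ((p : ℂ) * ((winCount c D.strat : ℕ) : ℂ) -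
      ∑ κ : ZMod p, ((winCount c (D.freeze g κ).strat : ℕ) : ℂ)) =
      ∑ κ : ZMod p, ∑ t ∈ (univ : Finset (ZMod p)).erase 0, ∑ u : Fin n → Bool, ψ κ u t * W κ u := by
    have hA : (p : ℂ) * ((winCount c D.strat : ℕ) : ℂ) =
        ∑ u : Fin n → Bool, ∑ κ : ZMod p, ∑ t : ZMod p, ψ κ u t * W κ u := by
      rw [winCount_eq_sum, Finset.mul_sum]
      refine Finset.sum_congr rfl fun u _ => ?_
      rw [hcouple u, Finset.mul_sum]
      exact Finset.sum_congr rfl fun κ _ => horth u κ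
    have hB : (∑ κ : ZMod p, ((winCount c (D.freeze g κ).strat : ℕ) : ℂ)) =
        ∑ u : Fin n → Bool, ∑ κ : ZMod p, ψ κ u 0 * W κ u := by
      rw [Finset.sum_comm]
      refine Finset.sum_congr rfl fun κ _ => ?_
      rw [winCount_eq_sum]
      refine Finset.sum_congr rfl fun u _ => ?_
      rw [hψ, hW]
      simp
    rw [hA, hB, ← Finset.sum_sub_distrib]
    have hu : ∀ u : Fin n → Bool, ((∑ κ : ZMod p, ∑ t : ZMod p, ψ κ u t * W κ u) - ∑ κ : ZMod p, ψ κ u 0 * W κ u) =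
        ∑ κ : ZMod p, ∑ t ∈ (univ : Finset (ZMod p)).erase 0, ψ κ u t * W κ u := by
      intro u
      rw [← Finset.sum_sub_distrib]
      refine Finset.sum_congr rfl fun κ _ => ?_
      rw [Finset.sum_erase_eq_sub h0mem]
    rw [Finset.sum_congr rfl fun u _ => hu u, Finset.sum_comm]
    refine Finset.sum_congr rfl fun κ _ => ?_
    rw [Finset.sum_comm]
  -- (4) each inner `u`-sum is a twisted win sum of a strategy BLIND to the private bits of `g`
  have hinner : ∀ (κ t : ZMod p), t ≠ 0 →
      ‖∑ u : Fin n → Bool, ψ κ u t * W κ u‖ ≤ 3 * ρ ^ D.priv g * (2 : ℝ) ^ n := by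
    intro κ t ht
    have hfac : ∀ u : Fin n → Bool, ψ κ u t * W κ u = (ZMod.stdAddChar (-(κ * t)) : ℂ) *
        (W κ u * (ZMod.stdAddChar (∑ i : Fin n, if u i then D.a g i * t else 0) : ℂ)) := by
      intro u
      rw [hψ]
      simp only
      have hsum : (D.form g u - κ) * t = (∑ i : Fin n, if u i then D.a g i * t else 0) + (-(κ * t)) := by
        unfold form
        rw [sub_mul, Finset.sum_mul]
        have : ∀ i : Fin n, (if u i then D.a g i else 0) * t = if u i then D.a g i * t else 0 := fun i => by
          split_ifs <;> simp
        rw [Finset.sum_congr rfl fun i _ => this i]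
        ring
      rw [hsum, AddChar.map_add_eq_mul]
      ring
    rw [Finset.sum_congr rfl fun u _ => hfac u, ← Finset.mul_sum, norm_mul,
      show ‖(ZMod.stdAddChar (-(κ * t)) : ℂ)‖ = 1 from by
        rw [show (ZMod.stdAddChar (-(κ * t)) : ℂ) = (ZMod.toCircle (-(κ * t)) : ℂ) from rfl, Circle.norm_coe],
      one_mul]
    have hP : ∀ i ∈ D.privSet g, D.a g i * t ≠ 0 := by
      intro i hi
      unfold privSet suppForm at hi
      rw [mem_filter, mem_filter] at hi
      exact mul_ne_zero hi.1.2 ht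
    have hblind : ∀ g' (u v : Fin n → Bool), (∀ i : Fin n, i ∉ D.privSet g → u i = v i) →
        (D.freeze g κ).strat g' u = (D.freeze g κ).strat g' v :=
      fun g' u v huv => strat_freeze_blind D g κ g' u v huv
    have key := UnreadTwist.unread_corr_win_le hρ hsite c (D.freeze g κ).strat (fun i => D.a g i * t) (D.privSet g) hP hblind
    unfold priv
    rw [hW]
    exact key
  -- (5) add up
  have hnorm : ‖(p : ℂ) * ((winCount c D.strat : ℕ) : ℂ) - ∑ κ : ZMod p, ((winCount c (D.freeze g κ).strat : ℕ) : ℂ)‖ ≤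
      (p : ℝ) * (p : ℝ) * (3 * ρ ^ D.priv g * (2 : ℝ) ^ n) := by
    rw [hdefect]
    have hb : 0 ≤ 3 * ρ ^ D.priv g * (2 : ℝ) ^ n := by positivity
    calc ‖∑ κ : ZMod p, ∑ t ∈ (univ : Finset (ZMod p)).erase 0, ∑ u : Fin n → Bool, ψ κ u t * W κ u‖
        ≤ ∑ κ : ZMod p, ‖∑ t ∈ (univ : Finset (ZMod p)).erase 0, ∑ u : Fin n → Bool, ψ κ u t * W κ u‖ :=
          norm_sum_le _ _
      _ ≤ ∑ κ : ZMod p, ∑ t ∈ (univ : Finset (ZMod p)).erase 0, ‖∑ u : Fin n → Bool, ψ κ u t * W κ u‖ :=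
          Finset.sum_le_sum fun κ _ => norm_sum_le _ _
      _ ≤ ∑ κ : ZMod p, ∑ t ∈ (univ : Finset (ZMod p)).erase 0, (3 * ρ ^ D.priv g * (2 : ℝ) ^ n) :=
          Finset.sum_le_sum fun κ _ => Finset.sum_le_sum fun t ht => hinner κ t (Finset.ne_of_mem_erase ht)
      _ ≤ ∑ κ : ZMod p, ∑ t : ZMod p, (3 * ρ ^ D.priv g * (2 : ℝ) ^ n) :=
          Finset.sum_le_sum fun κ _ =>
            Finset.sum_le_sum_of_subset_of_nonneg (Finset.erase_subset _ _) (fun _ _ _ => hb)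
      _ = (p : ℝ) * (p : ℝ) * (3 * ρ ^ D.priv g * (2 : ℝ) ^ n) := by
          rw [Finset.sum_const, Finset.sum_const, Finset.card_univ, ZMod.card, nsmul_eq_mul, nsmul_eq_mul]
          ring
  -- (6) back to `ℝ`
  have hcast : (p : ℂ) * ((winCount c D.strat : ℕ) : ℂ) - ∑ κ : ZMod p, ((winCount c (D.freeze g κ).strat : ℕ) : ℂ) =
      (((p : ℝ) * (winCount c D.strat : ℝ) - ∑ κ : ZMod p, (winCount c (D.freeze g κ).strat : ℝ) : ℝ) : ℂ) := by
    push_cast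
    ring
  have hre : (p : ℝ) * (winCount c D.strat : ℝ) - ∑ κ : ZMod p, (winCount c (D.freeze g κ).strat : ℝ) ≤
      ‖(p : ℂ) * ((winCount c D.strat : ℕ) : ℂ) - ∑ κ : ZMod p, ((winCount c (D.freeze g κ).strat : ℕ) : ℂ)‖ := by
    rw [hcast, Complex.norm_real, Real.norm_eq_abs]
    exact le_abs_self _
  exact hre.trans hnorm

/-- **The one-step hybrid (peeling) law — PROVED for every prime `p ≠ 3`** (constants `ρ = cos(π/(3p))`, `C = 3p`):
freezing ONE cut `g` at the best residue `κ` costs at most `C·ρ^{priv_D(g)}·2ⁿ` wins.  The per-site input is qn-lit's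
`TwoModuli.sum_norm_sq_twistStep_three_le`, exactly as in the tree's `twistBound`. -/
theorem hybrid_step (p : ℕ) [Fact p.Prime] (hp3 : p ≠ 3) :
    ∃ C ρ : ℝ, 0 ≤ C ∧ 0 ≤ ρ ∧ ρ < 1 ∧ ∀ (n c : ℕ) (D : JLinData p n) (g : Fin (n + 1)),
      ∃ κ : ZMod p, (winCount c D.strat : ℝ) ≤ C * ρ ^ D.priv g * (2 : ℝ) ^ n + (winCount c (D.freeze g κ).strat : ℝ) := by
  classical
  have hp2 : 2 ≤ p := (Fact.out : p.Prime).two_le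
  have hcop : p.Coprime 3 := (Nat.coprime_primes (Fact.out : p.Prime) Nat.prime_three).2 hp3
  have hpR : (2 : ℝ) ≤ p := by exact_mod_cast hp2
  have harg0 : 0 < Real.pi / (3 * p) := by positivity
  have harg1 : Real.pi / (3 * p) ≤ Real.pi / 2 := by
    rw [div_le_div_iff₀ (by positivity) (by norm_num)]
    nlinarith [Real.pi_pos]
  have hcos0 : 0 ≤ Real.cos (Real.pi / (3 * p)) := by
    apply Real.cos_nonneg_of_neg_pi_div_two_le_of_le
    · linarith [Real.pi_pos]
    · exact harg1
  have hcos1 : Real.cos (Real.pi / (3 * p)) < 1 := by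
    rw [← Real.cos_zero]
    exact Real.cos_lt_cos_of_nonneg_of_le_pi_div_two le_rfl harg1 harg0
  -- the per-site contraction (as in the tree's `twistBound`)
  have hsite : ∀ a : ZMod p, a ≠ 0 → ∀ v : ZMod 3 → ℂ,
      cnsq (twAvg (ZMod.stdAddChar a) v) ≤ Real.cos (Real.pi / (3 * p)) ^ 2 * cnsq v := by
    intro a ha v
    have h := Literature.Computability.MetaComplexity.TwoModuli.sum_norm_sq_twistStep_three_le hcop ha 1 2
      (X := Unit) (fun sx => v sx.1)
    rw [Fintype.sum_prod_type, Fintype.sum_prod_type] at h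
    simp only [Finset.sum_const, Finset.card_univ, Fintype.card_unit, one_smul] at h
    have hl : (∑ s : ZMod 3, ‖v (s + 1) + ZMod.stdAddChar a * v (s + 2)‖ ^ 2) =
        4 * cnsq (twAvg (ZMod.stdAddChar a) v) := by
      rw [show (∑ s : ZMod 3, ‖v (s + 1) + ZMod.stdAddChar a * v (s + 2)‖ ^ 2) =
        ‖v (0 + 1) + ZMod.stdAddChar a * v (0 + 2)‖ ^ 2 + ‖v (1 + 1) + ZMod.stdAddChar a * v (1 + 2)‖ ^ 2 +
        ‖v (2 + 1) + ZMod.stdAddChar a * v (2 + 2)‖ ^ 2 from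
        Fin.sum_univ_three (fun s : ZMod 3 => ‖v (s + 1) + ZMod.stdAddChar a * v (s + 2)‖ ^ 2)]
      unfold cnsq twAvg
      simp only [norm_div, Complex.norm_ofNat, div_pow]
      ring
    have hr : (∑ s : ZMod 3, ‖v s‖ ^ 2) = cnsq v := Fin.sum_univ_three (fun s : ZMod 3 => ‖v s‖ ^ 2)
    rw [hl, hr] at h
    nlinarith [cnsq_nonneg v, sq_nonneg (Real.cos (Real.pi / (3 * p)))]
  refine ⟨3 * p, Real.cos (Real.pi / (3 * p)), by positivity, hcos0, hcos1, ?_⟩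
  intro n c D g
  obtain ⟨κ, -, hmax⟩ := Finset.exists_max_image (univ : Finset (ZMod p))
    (fun κ => winCount c (D.freeze g κ).strat) univ_nonempty
  refine ⟨κ, ?_⟩
  have hdef := peel_defect_le hcos0 hsite c D g
  have hsum : (∑ κ' : ZMod p, (winCount c (D.freeze g κ').strat : ℝ)) ≤ (p : ℝ) * (winCount c (D.freeze g κ).strat : ℝ) := by
    calc (∑ κ' : ZMod p, (winCount c (D.freeze g κ').strat : ℝ))
        ≤ ∑ κ' : ZMod p, (winCount c (D.freeze g κ).strat : ℝ) :=
          Finset.sum_le_sum fun κ' _ => by exact_mod_cast hmax κ' (mem_univ _)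
      _ = (p : ℝ) * (winCount c (D.freeze g κ).strat : ℝ) := by
          rw [Finset.sum_const, Finset.card_univ, ZMod.card, nsmul_eq_mul]
  have hp : (0 : ℝ) < p := by positivity
  have key : (p : ℝ) * (winCount c D.strat : ℝ) ≤
      (p : ℝ) * (3 * p * Real.cos (Real.pi / (3 * p)) ^ D.priv g * (2 : ℝ) ^ n + (winCount c (D.freeze g κ).strat : ℝ)) := by
    have e : (p : ℝ) * (3 * p * Real.cos (Real.pi / (3 * p)) ^ D.priv g * (2 : ℝ) ^ n +
        (winCount c (D.freeze g κ).strat : ℝ)) =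
        (p : ℝ) * (winCount c (D.freeze g κ).strat : ℝ) +
          (p : ℝ) * (p : ℝ) * (3 * Real.cos (Real.pi / (3 * p)) ^ D.priv g * (2 : ℝ) ^ n) := by ring
    rw [e]
    linarith
  exact le_of_mul_le_mul_left key hp

end Hybrid

end Summit.QuantumAdvantage.AdviceFreeQNC0.JLinPeel

end
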